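import Mathlib

/-!
# Crux `FeketeSOS.CharPSparseSOS` (stmt-ValiantsHypothesis-14989), line `Sketch` — the two-cusp
inequality, non-cancelling (fat) branch for a general number `s` of squares

For a non-zero fold `P = (Σ_{i<s} c_i g_i²) mod (X^p − 1)` over a field `K` of characteristic `p` and
depth `D` at the upper cusp (`(X − 1)^D ∣ P`): if `m` is a common lower bound for the `(X − 1)`-orders
`ord₁ g_i` of all LIVE squares (`c_i ≠ 0`, `g_i ≠ 0`) and the leading `(X − 1)`-adic coefficients do not
cancel, i.e. `Σ_i c_i h_i(1)² ≠ 0` with `h_i = g_i / (X − 1)^m`, then `D ≤ 2m`.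

Proof.  `P ≠ 0` gives `D ≤ deg P < p`, and `X^p − 1 = (X − 1)^p` in characteristic `p`, so `(X − 1)^D`
divides the un-folded sum `F = Σ c_i g_i² = P + (X^p − 1) · (F / (X^p − 1))` as well.  Every summand
satisfies `c_i g_i² = (X − 1)^{2m} · c_i h_i²` (dead squares give `0 = 0`; live ones have
`g_i = (X − 1)^m h_i` exactly), so `F = (X − 1)^{2m} G` with `G = Σ c_i h_i²` and `G(1) = Σ c_i h_i(1)² ≠ 0`.
If `D ≥ 2m + 1`, cancelling `(X − 1)^{2m}` would give `(X − 1) ∣ G`, i.e. `G(1) = 0` — a contradiction.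
-/

-- `Summit.ValiantsHypothesis.ValiantsHypothesis.…` is the tree's mandated single-conjunct layout (Sub = Summit).
set_option linter.dupNamespace false

namespace Summit.ValiantsHypothesis.ValiantsHypothesis.Theorems.CharPSparseSOSTwoCusp

open Polynomial Finset

/-- **Two-cusp inequality, non-cancelling branch (general `s`).**  Over a field `K` of characteristic
`p`, let `P = (Σ_{i<s} c_i g_i²) mod (X^p − 1)` be non-zero with `(X − 1)^D ∣ P`.  If `m ≤ ord₁ g_i` for
every live square (`c_i ≠ 0`, `g_i ≠ 0`) and `Σ_i c_i · (g_i /ₘ (X − 1)^m)(1)² ≠ 0` (the leading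
`(X − 1)`-adic terms of the squares do not cancel), then `D ≤ 2m`. -/
theorem twoCuspInequality_nonCancelling :
    ∀ (K : Type) [Field K] (p : ℕ) [Fact p.Prime] [CharP K p] (s : ℕ) (c : Fin s → K) (g : Fin s → K[X])
      (P : K[X]) (D m : ℕ), (∀ i, (g i).natDegree < p) → P = (∑ i, C (c i) * g i ^ 2) %ₘ (X ^ p - 1) →
      P ≠ 0 → (X - C (1 : K)) ^ D ∣ P → (∀ i, c i ≠ 0 → g i ≠ 0 → m ≤ (g i).rootMultiplicity 1) →
      (∑ i, c i * ((g i /ₘ (X - C (1 : K)) ^ m).eval 1) ^ 2 ≠ 0) → D ≤ 2 * m := by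
  intro K _ p _ _ s c g P D m _ hP hP0 hD hm hG
  have hprime : p.Prime := Fact.out
  have hp : 0 < p := hprime.pos
  have hmonic : ((X : K[X]) ^ p - 1).Monic :=
    monic_X_pow_sub (by rw [degree_one]; exact_mod_cast hp)
  -- `deg P < p`, hence `D ≤ deg P < p`.
  have hdegP : P.natDegree < p := by
    have hq1 : ((X : K[X]) ^ p - 1) ≠ 1 := by
      intro h
      have := congrArg natDegree h
      rw [← C_1, natDegree_X_pow_sub_C, natDegree_C] at this
      omega
    have h := natDegree_modByMonic_lt (∑ i, C (c i) * g i ^ 2) hmonic hq1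
    rw [← C_1, natDegree_X_pow_sub_C] at h
    rw [hP, ← C_1]; exact h
  have hDp : D ≤ p := by
    have h := natDegree_le_of_dvd hD hP0
    rw [(monic_X_sub_C (1 : K)).natDegree_pow, natDegree_X_sub_C, mul_one] at h
    omega
  -- Frobenius: `X^p − 1 = (X − 1)^p`, so `(X − 1)^D` divides the un-folded sum `F` as well.
  have hXp : (X - C (1 : K)) ^ p = X ^ p - 1 := by
    rw [sub_pow_char, ← C_pow, one_pow, C_1]
  have hDF : (X - C (1 : K)) ^ D ∣ ∑ i, C (c i) * g i ^ 2 := by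
    rw [← modByMonic_add_div (∑ i, C (c i) * g i ^ 2) ((X : K[X]) ^ p - 1), ← hP]
    refine dvd_add hD (dvd_mul_of_dvd_left ?_ _)
    rw [← hXp]
    exact pow_dvd_pow _ hDp
  clear hD hdegP hDp
  -- Factor `F = ((X − 1)^m)² · G` summand by summand, `G = Σ c_i h_i²` with `h_i = g_i /ₘ (X − 1)^m`.
  have hMmonic : ((X - C (1 : K)) ^ m).Monic := (monic_X_sub_C (1 : K)).pow m
  have hfac : ∀ i, C (c i) * g i ^ 2 =
      ((X - C (1 : K)) ^ m) ^ 2 * (C (c i) * (g i /ₘ (X - C (1 : K)) ^ m) ^ 2) := by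
    intro i
    by_cases hci : c i = 0
    · rw [hci, C_0]
      ring
    by_cases hgi : g i = 0
    · rw [hgi, zero_divByMonic]
      ring
    have hdvd : (X - C (1 : K)) ^ m ∣ g i :=
      (pow_dvd_pow _ (hm i hci hgi)).trans (pow_rootMultiplicity_dvd (g i) 1)
    have h := modByMonic_add_div (g i) ((X - C (1 : K)) ^ m)
    rw [(modByMonic_eq_zero_iff_dvd hMmonic).2 hdvd, zero_add] at h
    calc C (c i) * g i ^ 2
        = C (c i) * ((X - C (1 : K)) ^ m * (g i /ₘ (X - C (1 : K)) ^ m)) ^ 2 := by rw [h]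
      _ = _ := by ring
  have hS : ∑ i, C (c i) * g i ^ 2 =
      ((X - C (1 : K)) ^ m) ^ 2 * ∑ i, C (c i) * (g i /ₘ (X - C (1 : K)) ^ m) ^ 2 := by
    rw [Finset.mul_sum]
    exact Finset.sum_congr rfl fun i _ => hfac i
  -- `D ≤ 2m`: otherwise `(X − 1) ∣ G`, whose value at `1` is `Σ c_i h_i(1)² ≠ 0`.
  by_contra hlt
  rw [not_le] at hlt
  have hdvd : (X - C (1 : K)) ^ (2 * m + 1) ∣ ∑ i, C (c i) * g i ^ 2 :=
    (pow_dvd_pow _ (Nat.succ_le_of_lt hlt)).trans hDF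
  have hpow : (X - C (1 : K)) ^ (2 * m + 1) = ((X - C (1 : K)) ^ m) ^ 2 * (X - C 1) := by
    rw [pow_succ (X - C (1 : K)) (2 * m), pow_mul' (X - C (1 : K)) 2 m]
  rw [hpow, hS, mul_dvd_mul_iff_left (pow_ne_zero 2 hMmonic.ne_zero), dvd_iff_isRoot] at hdvd
  have h := hdvd.eq_zero
  simp only [eval_finsetSum, eval_mul, eval_C, eval_pow] at h
  exact hG h

end Summit.ValiantsHypothesis.ValiantsHypothesis.Theorems.CharPSparseSOSTwoCusp
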